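import Summits.HodgeConjecture.HodgeConjecture.Theorems.MarkmanPartnerTransportPicardThreeK3SquaresNikulinIsogeny
import Literature.AlgebraicGeometry.Surfaces.GeometricGenusOneAssociatedK3Surface
import Literature.NumberTheory.QuadraticForms.QuadraticFormInvariants

/-!
# Route MarkmanPartnerTransport · crux `PicardThreeK3Squares` (stmt-HodgeConjecture-19652) —
# the marked rational transcendental lattice embeds into any diagonal rational form of codimension `≥ 3`
# with enough positive and negative weights (Kitaoka Cor. 4.1.4, read through a marking)

Lattice engine for the `√3`-sector (`…PicardFifteenSqrtThree`, consumer of the named fact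
`Varesco2023_sqrtThree_algebraic_of_transcendental_embedding`, whose hypothesis is an isometric embedding
of the transcendental coordinate vectors into the diagonal form `⟨1,1,1,−1,−1,−1,−2,−6,−2,−6⟩ =
(U³ ⊕ A₂²) ⊗ ℚ`), and for any further "`T(X) ⊆ Γ_ℚ`" criterion (Varesco 2023 Prop. 2.5 / 2.11,
Floccari's `U³ ⊕ ⟨−2m⟩`): for a marked projective K3 surface `(S, η, p, x)` (the crux's clauses) and
weights `w : Fin m → ℚ`, all non-zero, with at least `3` positive and at least `22 − ρ(S)` negative ones
and `22 − ρ(S) + 3 ≤ m`, there is a `ℚ`-linear `ι : ℚ²² → ℚ^m` which is ISOMETRIC on the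
transcendental coordinate vectors (`IsTranscendentalCoord S η v`: `η⁻¹(v) ∈ T(S)`) for the diagonal form
`Σ wᵢ aᵢ bᵢ` against `k3FormRat`, and INJECTIVE there. Proof: the transcendental coordinate vectors lie
in `T = N_ℚ^⊥` (`N_ℚ` the rational points of `N¹H²`, through the marking; Lefschetz `(1,1)`), on which
the K3 form is non-degenerate (Hodge index) with `b⁺ ≤ 3` (`sigPos_restrict_le_three`) and
`dim T ≤ 22 − ρ(S)`; Kitaoka's codimension-`3` representation theorem
(`exists_isometry_of_sigPos_le_of_sigNeg_le_of_finrank_add_three_le`, PROVED in the tree) embeds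
`(T, q)` into `⟨w⟩`; extend by zero along `N_ℚ` and polarise.

* `exists_transcendentalEmbedding_weightedSumSquares` — the lemma.

No definition, no named fact, no sorry. Prover seat hodge-nonav-19652-p1 (gen 4),
`--supports stmt-HodgeConjecture-19652`.

References: Y. Kitaoka, *Arithmetic of Quadratic Forms* (CUP 1993), Cor. 4.1.4; O. T. O'Meara,
*Introduction to Quadratic Forms*, 63:21, 66:3; M. Varesco, Math. Z. 305 (2023), Prop. 2.5, Prop. 2.11;
D. Huybrechts, *Lectures on K3 Surfaces*, Ch. 3 Lemma 3.3.1, Ch. 14 §0.3.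
-/

set_option linter.dupNamespace false

noncomputable section

namespace Summit.HodgeConjecture.HodgeConjecture.Theorems.MarkmanPartnerTransport.NikulinIsogeny

open scoped TensorProduct
open Module QuadraticMap CategoryTheory MonoidalCategory
open Literature.AlgebraicGeometry Literature.AlgebraicGeometry.Motives Literature.AlgebraicGeometry.HodgeTheory
open Literature.AlgebraicGeometry.Surfaces
open Literature.AlgebraicTopology.SingularHomology
open Literature.NumberTheory.QuadraticForms
open Summit.HodgeConjecture.HodgeConjecture.Theorems
open Summit.HodgeConjecture.HodgeConjecture.Theorems.NikulinTwinTransport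
open Summit.HodgeConjecture.HodgeConjecture.Theorems.AnchorExistenceCMFloor

variable {S : SchemeOver ℂ}

/-- `MarkedK3[S, η, p, x]`: VERBATIM the `let MarkedK3 := …` binder of the route declaration
`PicardThreeK3Squares`. Local notation only. -/
local notation3 (prettyPrint := false) "MarkedK3[" S ", " η ", " p ", " x "]" =>
  (p ≠ 0 ∧ (IsIntegralClass p ∧
    (∀ q : complexBetti S (2 * 2), IsIntegralClass q → ∃ n : ℤ, q = n • p) ∧
    (∀ c : complexBetti S (2 * 1), IsIntegralClass c ↔ ∃ v : K3Index → ℤ, η c = fun i => (v i : ℂ)) ∧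
    (∀ a b : complexBetti S (2 * 1),
      cupProduct (rfl : 2 * 1 + 2 * 1 = 2 * 2) a b = k3Form (η a) (η b) • p) ∧
    IsOfHodgeType 2 S (2 * 1) 2 0 (LinearEquiv.symm η x) ∧
    (∀ τ : complexBetti S (2 * 1), IsOfHodgeType 2 S (2 * 1) 2 0 τ →
      ∃ t : ℂ, τ = t • LinearEquiv.symm η x)) ∧
    (k3Form x x = 0 ∧ 0 < (k3Form (star x) x).re ∧
      ∃ u : K3Index → ℤ, k3Form (fun i => (u i : ℂ)) x = 0 ∧ 0 < ∑ i, ∑ j, u i * k3Gram i j * u j))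

/-- **The marked rational transcendental lattice embeds into every diagonal rational form with enough
positive and negative weights in codimension `≥ 3`.** For a marked projective K3 surface `(S, η, p, x)`
and non-zero weights `w : Fin m → ℚ` with `3 ≤ #{i : wᵢ > 0}`, `22 − ρ(S) ≤ #{i : wᵢ < 0}` and
`22 − ρ(S) + 3 ≤ m`, there is a `ℚ`-linear `ι : ℚ²² → ℚ^m` with
`Σᵢ wᵢ (ι v)ᵢ (ι v')ᵢ = k3FormRat v v'` for all transcendental coordinate vectors `v, v'`
(`IsTranscendentalCoord S η`), injective on them. Proof: those vectors lie in `T = N_ℚ^⊥`, non-degenerate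
of positive index `≤ 3` and dimension `≤ 22 − ρ(S)`; Kitaoka Cor. 4.1.4
(`exists_isometry_of_sigPos_le_of_sigNeg_le_of_finrank_add_three_le`) gives an injective isometry
`(T, q) → ⟨w⟩`, extended by zero along `N_ℚ`; the bilinear identity is the polarisation of the quadratic
one. [cite: Kitaoka1993, Ch. 4 Cor. 4.1.4] [cite: Varesco2023, Prop. 2.5 (proof) and Prop. 2.11]
[cite: Huybrechts2016K3, Ch. 3 Lemma 3.3.1 and Ch. 14 §0.3 (vi)] -/
theorem exists_transcendentalEmbedding_weightedSumSquares (hS : IsK3Surface S)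
    (η : complexBetti S (2 * 1) ≃ₗ[ℂ] (K3Index → ℂ)) (p : complexBetti S (2 * 2)) (x : K3Index → ℂ)
    (hM : MarkedK3[S, η, p, x]) {m : ℕ} (w : Fin m → ℚ) (hw : ∀ i, w i ≠ 0)
    (hwpos : 3 ≤ {i | 0 < w i}.ncard)
    (hwneg : 22 - Module.finrank ℂ ↥(algebraicClasses S 1) ≤ {i | w i < 0}.ncard)
    (hwm : 22 - Module.finrank ℂ ↥(algebraicClasses S 1) + 3 ≤ m) :
    ∃ ι : (K3Index → ℚ) →ₗ[ℚ] (Fin m → ℚ),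
      (∀ v v' : K3Index → ℚ, IsTranscendentalCoord S η v → IsTranscendentalCoord S η v' →
        ∑ i, w i * ι v i * ι v' i = k3FormRat v v') ∧
      (∀ v : K3Index → ℚ, IsTranscendentalCoord S η v → ι v = 0 → v = 0) := by
  classical
  have h4 : 2 * 1 + 2 * 1 = 2 * 2 := rfl
  have hHT : Huybrechts_K3_hodgeTypes_H2 := Huybrechts_K3_hodgeTypes_H2_holds
  obtain ⟨hp₀, ⟨-, -, hηint, hηcup, hx20, -⟩, -, hxpos, -⟩ := hM
  set N := algebraicClasses S 1 with hNdef
  set σ := η.symm x with hσdef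
  have hησ : η σ = x := by rw [hσdef, LinearEquiv.apply_symm_apply]
  have hxne : σ ≠ 0 := fun h0 => ne_zero_of_star_self_re_pos hxpos (by rw [← hησ, h0, map_zero])
  obtain ⟨-, -, h₃⟩ := hHT S hS σ hx20 hxne
  have hσbar : conjClass (ComplexPoints S) (2 * 1) σ = η.symm (star x) :=
    conjClass_marking_symm η hηint x
  have hsmul0 : ∀ {c : ℂ}, c • p = 0 → c = 0 := fun h => by
    rcases smul_eq_zero.1 h with h | h
    · exact h
    · exact absurd h hp₀
  have hL11 : ∀ c : complexBetti S (2 * 1), IsRationalClass c → IsOfHodgeType 2 S (2 * 1) 1 1 c → c ∈ N :=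
    fun c hc h11 => lefschetzOneOne_rational_holds hS.1 c hc h11
  have hND : ∀ c ∈ N, IsRationalClass c →
      (∀ d ∈ N, cupProduct (rfl : 2 * 1 + 2 * 1 = 2 * 2) c d = 0) → c = 0 :=
    fun c hcN hc hperp => anchorExistence_cmFloor_divisorClass_eq_zero_of_hodgeIndex
      hodgeIndex_surface_holds lefschetzOneOne_rational_holds
      Grothendieck1969_supportedClasses_le_hodgeConiveau_holds hS hcN hc hperp
  have hrat : ∀ c, IsRationalClass c ↔ ∃ w : K3Index → ℚ, η c = fun i => (w i : ℂ) :=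
    isRationalClass_iff_of_marking hS η hηint
  -- the rational points of `N`
  let NQ : Submodule ℚ (K3Index → ℚ) :=
    { carrier := {u | η.symm (fun j => (u j : ℂ)) ∈ N}
      add_mem' := fun {u v} hu hv => by
        simp only [Set.mem_setOf_eq, ratCastΛ_add, map_add]
        exact N.add_mem hu hv
      zero_mem' := by
        simp only [Set.mem_setOf_eq, ratCastΛ_zero, map_zero]
        exact N.zero_mem
      smul_mem' := fun q u hu => by
        simp only [Set.mem_setOf_eq, ratCastΛ_smul, map_smul]
        exact N.smul_mem _ hu }
  have memNQ : ∀ u, u ∈ NQ ↔ η.symm (fun j => (u j : ℂ)) ∈ N := fun u => Iff.rfl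
  have h11_iff : ∀ v : K3Index → ℂ, IsOfHodgeType 2 S (2 * 1) 1 1 (η.symm v) ↔
      (k3Form v x = 0 ∧ k3Form v (star x) = 0) := by
    intro v
    rw [h₃ (η.symm v), hηcup, hηcup, LinearEquiv.apply_symm_apply, hησ, hσbar, LinearEquiv.apply_symm_apply]
    constructor
    · rintro ⟨ha, hb⟩
      exact ⟨hsmul0 ha, hsmul0 hb⟩
    · rintro ⟨ha, hb⟩
      rw [ha, hb, zero_smul]
      exact ⟨rfl, rfl⟩
  have hN : ∀ u : K3Index → ℚ, u ∈ NQ ↔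
      (k3Form (fun i => (u i : ℂ)) x = 0 ∧ k3Form (fun i => (u i : ℂ)) (star x) = 0) := by
    intro u
    rw [memNQ, ← h11_iff]
    constructor
    · intro hu
      exact isOfHodgeType_of_mem_algebraicClasses_of_isSmoothProjective hS.1 1 hu
    · intro hu
      exact hL11 _ ((hrat _).2 ⟨u, LinearEquiv.apply_symm_apply _ _⟩) hu
  have hspan := span_isRationalClass_eq_top_of_isSmoothProjective_holds.supportedClasses_eq_span
    hS.1 (2 * 1) 1
  have horth : ∀ u ∈ k3FormRat.orthogonal NQ, ∀ d ∈ N, k3Form (fun j => (u j : ℂ)) (η d) = 0 := by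
    intro u hu d hd
    rw [LinearMap.BilinForm.mem_orthogonal_iff] at hu
    have hd' : d ∈ Submodule.span ℂ {c : complexBetti S (2 * 1) |
        IsRationalClass c ∧ c ∈ supportedClasses S (2 * 1) 1} := by
      rw [← hspan]; exact hd
    clear hd
    induction hd' using Submodule.span_induction with
    | mem d hd =>
      obtain ⟨w', hw'⟩ := (hrat d).1 hd.1
      have hwN : w' ∈ NQ := by
        rw [memNQ, ← hw', LinearEquiv.symm_apply_apply]
        exact hd.2
      rw [hw', k3Form_ratCast, k3FormRat_isSymm.eq, hu w' hwN, Rat.cast_zero]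
    | zero => rw [map_zero, k3Form_zero_right]
    | add c c' _ _ hc hc' => rw [map_add, k3Form_add_right, hc, hc', add_zero]
    | smul t c _ hc => rw [map_smul, k3Form_smul_right, hc, mul_zero]
  have hdisj : Disjoint NQ (k3FormRat.orthogonal NQ) := by
    rw [Submodule.disjoint_def]
    intro u huN huT
    have hc0 : η.symm (fun j => (u j : ℂ)) = 0 :=
      hND _ ((memNQ u).1 huN) ((hrat _).2 ⟨u, LinearEquiv.apply_symm_apply _ _⟩) fun d hd => by
        rw [hηcup, LinearEquiv.apply_symm_apply, horth u huT d hd, zero_smul]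
    apply ratCastΛ_injective
    rw [ratCastΛ_zero]
    exact η.symm.injective (hc0.trans (map_zero _).symm)
  have hc := isCompl_orthogonal hdisj
  set T := k3FormRat.orthogonal NQ with hTdef
  -- `dim_ℚ N_ℚ ≥ dim_ℂ N`, hence `dim_ℚ T ≤ 22 − ρ(S)`
  have hdimN : Module.finrank ℂ ↥N ≤ Module.finrank ℚ ↥NQ := by
    let b := Module.finBasis ℚ NQ
    let c : Fin (Module.finrank ℚ ↥NQ) → complexBetti S (2 * 1) :=
      fun i => η.symm (fun j => (((b i : NQ) : K3Index → ℚ) j : ℂ))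
    have hle : N ≤ Submodule.span ℂ (Set.range c) := by
      intro d hd
      have hd' : d ∈ Submodule.span ℂ {c : complexBetti S (2 * 1) |
          IsRationalClass c ∧ c ∈ supportedClasses S (2 * 1) 1} := by
        rw [← hspan]; exact hd
      refine Submodule.span_le.2 ?_ hd'
      rintro d ⟨hdQ, hdN⟩
      obtain ⟨w', hw'⟩ := (hrat d).1 hdQ
      have hwN : w' ∈ NQ := by
        rw [memNQ, ← hw', LinearEquiv.symm_apply_apply]
        exact hdN
      have hd_eq : d = η.symm (fun j => (w' j : ℂ)) := by rw [← hw', LinearEquiv.symm_apply_apply]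
      have hw_eq : (w' : K3Index → ℚ) = ∑ i, (b.repr ⟨w', hwN⟩ i) • ((b i : NQ) : K3Index → ℚ) := by
        have h := congrArg (fun t : NQ => (t : K3Index → ℚ)) (b.sum_repr ⟨w', hwN⟩).symm
        simpa only [Submodule.coe_sum, Submodule.coe_smul] using h
      rw [SetLike.mem_coe, hd_eq, hw_eq, ratCastΛ_sum, map_sum]
      refine Submodule.sum_mem _ fun i _ => ?_
      rw [ratCastΛ_smul, map_smul]
      exact Submodule.smul_mem _ _ (Submodule.subset_span ⟨i, rfl⟩)
    haveI : Module.Finite ℂ ↥(Submodule.span ℂ (Set.range c)) :=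
      Module.Finite.span_of_finite ℂ (Set.finite_range c)
    exact (Submodule.finrank_mono hle).trans ((finrank_range_le_card c).trans (by simp))
  have hdimT : Module.finrank ℚ ↥T ≤ 22 - Module.finrank ℂ ↥N := by
    rw [hTdef, LinearMap.BilinForm.finrank_orthogonal k3FormRat_nondegenerate, finrank_k3Rat]
    omega
  -- `T` is non-degenerate
  have hTnd : ∀ t ∈ T, (∀ t' ∈ T, k3FormRat t t' = 0) → t = 0 := by
    intro t ht hperp
    have hdisj' := disjoint_orthogonal_orthogonal hdisj
    rw [Submodule.disjoint_def] at hdisj'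
    refine hdisj' t ht ?_
    rw [LinearMap.BilinForm.mem_orthogonal_iff]
    intro t' ht'
    change k3FormRat t' t = 0
    rw [k3FormRat_isSymm.eq]
    exact hperp t' ht'
  -- transcendental coordinate vectors lie in `T`
  have hcoordT : ∀ v : K3Index → ℚ, IsTranscendentalCoord S η v → v ∈ T := by
    intro v hv
    rw [isTranscendentalCoord_iff, mem_transcendentalSubspace_iff_forall_algebraicClasses hS.1] at hv
    rw [hTdef, LinearMap.BilinForm.mem_orthogonal_iff]
    intro n hn
    change k3FormRat n v = 0
    have h := hv _ ((memNQ n).1 hn)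
    rw [hηcup, LinearEquiv.apply_symm_apply, LinearEquiv.apply_symm_apply, k3Form_ratCast] at h
    rw [k3FormRat_isSymm.eq]
    exact_mod_cast hsmul0 h
  -- the quadratic spaces `(T, q|_T)` and `⟨w⟩`
  set B : LinearMap.BilinForm ℚ (K3Index → ℚ) := k3FormRat with hBdef
  set QΛ : QuadraticForm ℚ (K3Index → ℚ) := B.toQuadraticMap with hQΛ
  have hQΛapp : ∀ v, QΛ v = B v v := fun v => rfl
  have hBsymm : ∀ v v', B v v' = B v' v := fun v v' => k3FormRat_isSymm.eq v v'
  set QV : QuadraticForm ℚ (Fin m → ℚ) := weightedSumSquares ℚ w with hQVdef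
  have hQVapp : ∀ a : Fin m → ℚ, QV a = ∑ i, w i * (a i * a i) := fun a => by
    rw [hQVdef, weightedSumSquares_apply]
    rfl
  have hsepT : (QuadraticMap.associated (R := ℚ) (QΛ.restrict T)).SeparatingLeft := by
    have hQW : QΛ.restrict T = (B.restrict T).toQuadraticMap := QuadraticMap.ext fun t => rfl
    have hassoc : QuadraticMap.associated (R := ℚ) (QΛ.restrict T) = B.restrict T := by
      rw [hQW]
      exact QuadraticMap.associated_left_inverse ℚ (fun a b => hBsymm a b)
    intro t ht
    rw [hassoc] at ht
    exact Subtype.ext (hTnd t t.2 fun t' ht' => ht ⟨t', ht'⟩)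
  have hsepV : (QuadraticMap.associated (R := ℚ) QV).SeparatingLeft :=
    (separatingLeft_weightedSumSquares_iff w).2 hw
  have hposT : sigPos (QΛ.restrict T) ≤ sigPos QV := by
    rw [hQVdef, QuadraticForm.sigPos_weightedSumSquares]
    exact (sigPos_restrict_le_three T).trans hwpos
  have hnegT : sigNeg (QΛ.restrict T) ≤ sigNeg QV := by
    rw [hQVdef, QuadraticForm.sigNeg_weightedSumSquares]
    have h : sigNeg (QΛ.restrict T) ≤ finrank ℚ T := by
      rw [← sigPos_neg]
      exact sigPos_le_finrank _
    omega
  have hdim3 : finrank ℚ T + 3 ≤ finrank ℚ (Fin m → ℚ) := by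
    rw [finrank_fintype_fun_eq_card, Fintype.card_fin]
    omega
  obtain ⟨f, hf⟩ := exists_isometry_of_sigPos_le_of_sigNeg_le_of_finrank_add_three_le
    (QΛ.restrict T) QV hsepT hsepV hdim3 hposT hnegT
  -- polarisation: `f` is isometric for the bilinear forms
  have hsq : ∀ u : T, ∑ i, w i * f u i * f u i = B u u := fun u => by
    have h := f.map_app u
    rw [hQVapp, QuadraticMap.restrict_apply, hQΛapp] at h
    rw [← h]
    exact Finset.sum_congr rfl fun i _ => by ring
  have hfB : ∀ t t' : T, ∑ i, w i * f t i * f t' i = B t t' := by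
    intro t t'
    have hadd := hsq (t + t')
    have e1 : ((t + t' : T) : K3Index → ℚ) = (t : K3Index → ℚ) + (t' : K3Index → ℚ) := rfl
    have e2 : (f (t + t') : Fin m → ℚ) = f t + f t' := map_add f t t'
    rw [e2, e1] at hadd
    have lhs : ∑ i, w i * (f t + f t') i * (f t + f t') i =
        ∑ i, w i * f t i * f t i + 2 * ∑ i, w i * f t i * f t' i + ∑ i, w i * f t' i * f t' i := by
      rw [Finset.mul_sum, ← Finset.sum_add_distrib, ← Finset.sum_add_distrib]
      exact Finset.sum_congr rfl fun i _ => by simp only [Pi.add_apply]; ring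
    have rhs : B ((t : K3Index → ℚ) + t') ((t : K3Index → ℚ) + t') =
        B t t + 2 * B t t' + B t' t' := by
      rw [LinearMap.map_add₂, map_add, map_add, hBsymm (t' : K3Index → ℚ) t]
      ring
    rw [lhs, rhs, hsq t, hsq t'] at hadd
    linarith
  -- extend by zero along `N_ℚ`
  let π : (K3Index → ℚ) →ₗ[ℚ] T := T.projectionOnto NQ hc.symm
  have hπ : ∀ v (hv : v ∈ T), π v = ⟨v, hv⟩ := fun v hv =>
    Submodule.projectionOnto_apply_of_mem_left hc.symm hv
  refine ⟨f.toLinearMap ∘ₗ π, fun v v' hv hv' => ?_, fun v hv h0 => ?_⟩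
  · rw [LinearMap.comp_apply, LinearMap.comp_apply, hπ v (hcoordT v hv), hπ v' (hcoordT v' hv')]
    exact hfB ⟨v, hcoordT v hv⟩ ⟨v', hcoordT v' hv'⟩
  · rw [LinearMap.comp_apply, hπ v (hcoordT v hv)] at h0
    have h1 : (⟨v, hcoordT v hv⟩ : T) = 0 := hf (by rw [map_zero]; exact h0)
    exact congrArg Subtype.val h1

end Summit.HodgeConjecture.HodgeConjecture.Theorems.MarkmanPartnerTransport.NikulinIsogeny

end
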